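import Summits.AnomalousDissipation.AnomalousDissipation.Theses.EnsembleRigidity
import Summits.AnomalousDissipation.AnomalousDissipation.Theorems.EnsembleRigidityDefs
import Summits.AnomalousDissipation.AnomalousDissipation.Theorems.GPMeanBoundedFamily.Negative.LevelFloor
import Summits.AnomalousDissipation.AnomalousDissipation.Theorems.TaylorCertificatesSteadyStatesLoudBoundedStubGpAdmissible
import Literature.Analysis.FluidPDE.DoeringFoiasProofs
import Literature.Analysis.FluidPDE.DoeringFoiasPowerProofs

/-!
# STRATEGY CENSUS — typed companion (crux `GPMeanBoundedFamily`, stmt-AnomalousDissipation-15509)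

Crux-strategist seat `planner-cstrat-stmt-AnomalousDissipation-15509-b1-0` (route TameRoughRigidity; the crux is
SHARED with EnsembleRigidity and byte-identical there — see the docstring of `B`).  Prose lives in `STRATEGY-CENSUS.md`; this file
only TYPES the census' attempts and PROVES the cheap implications between them, so that every "no leverage" claim in
the census points at a kernel-checked statement.  Nothing here closes the item.  `sorry`-free.

* §0 `crux_iff` — the crux (`B`) unfolded at `gpForce`; `IsLiftedFamily` = its frame (viscosities in `(0,1]` tending to
  `0`, global Leray–Hopf paths of NS_{ν_j}(f_GP), `H`-valued lifts).
* §1 `meanDissipation_le` — the Doering–Foias power budget at f_GP: `ε ≤ √(3/2)·√E` for every global Leray–Hopf path.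
* §S STRENGTHEN.  `RelativeFloorFamily c` (S⁺_rel: SOME lifted family pays `ε_j ≥ c·E_j`).  PROVED:
  `crux_of_relativeFloor` (S⁺_rel → B with `E = 3/(2c²)`), `anomalousDissipation_of_relativeFloor` (S⁺_rel → the SUMMIT,
  via the landed level floor `Negative.exists_meanEnergy_floor`), and the converse `relativeFloor_of_gpZerothLawLifted`
  (the lifted zeroth law AT f_GP gives S⁺_rel with `c = ε/E`).  So the only multiplicative strengthening of B that the
  energy inequality can use is EQUIVALENT to the summit at f_GP: it buys nothing short of the summit.
  `crux_of_gpZerothLawLifted` records that B is the NECESSARY half of the lifted zeroth law at f_GP.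
* §D DECOMPOSITION.  `GPEnsembleMeanBoundedFamily` (Sub₁: mean-bounded stationary statistical solutions along
  ν_j → 0) and `MeanRealisation` (Sub₂: an FMRT stationary statistical solution of NS_ν(f_GP) with mean energy ≤ E is
  accompanied by ONE lifted global Leray–Hopf path with `meanEnergy ≤ E + δ`); PROVED glue
  `crux_of_ensembleSplit : Sub₁ → Sub₂ → B` (a 4-line composition along `j` — the seam is thin, which is the point made
  in the census: the split relocates the kernel into Sub₁).
* §N NEGATION.  `RestFamilyDiverges` (the mean energy of EVERY lifted Leray–Hopf path FROM REST exceeds every level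
  once ν is small) and `restFamilyDiverges_of_not_crux : ¬B → RestFamilyDiverges` (PROVED): the first thing any
  disproof must deliver, and the thing every DNS of the hub contradicts (odd/full-space rest runs, j020430/j020536).
-/

noncomputable section

-- `Summit.<Summit>.<Problem>` repeats the summit segment by the D-0017 layout.
set_option linter.dupNamespace false

open MeasureTheory Filter Topology Set

namespace Summit.AnomalousDissipation.AnomalousDissipation.Cruxes.GPMeanBoundedFamily.StrategyCensus

open Literature.Analysis Literature.Analysis.FunctionSpaces Literature.Analysis.FluidPDE
open Summit.AnomalousDissipation.AnomalousDissipation.Theorems.EnsembleRigidity (gpForce gpForce_eq)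

/-! ## §0 The crux of THIS route, shared with EnsembleRigidity -/

/-- The crux `B` (item stmt-AnomalousDissipation-15509), stated through its EnsembleRigidity copy.  The TameRoughRigidity copy
`Summit.AnomalousDissipation.AnomalousDissipation.Theses.TameRoughRigidity.GPMeanBoundedFamily` has a byte-identical body, so
`TameRoughRigidity.GPMeanBoundedFamily ↔ EnsembleRigidity.GPMeanBoundedFamily := Iff.rfl` (checked in the evidence copy of this file,
which imports `Theses.TameRoughRigidity`; this crux-dir copy imports the parent route file only, to stay buildable while the farm reports
the child route file mid-rewrite). -/
abbrev B : Prop :=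
  Summit.AnomalousDissipation.AnomalousDissipation.Theses.EnsembleRigidity.GPMeanBoundedFamily

/-- `f_GP` is smooth, solenoidal and mean zero (landed `stub_gpAdmissible`; `gpForce` is the inline force by `rfl`). -/
theorem gpForce_admissible :
    Torus.IsSmooth gpForce ∧ Torus.IsDivFree gpForce ∧ Torus.HasZeroMean gpForce :=
  Summit.AnomalousDissipation.AnomalousDissipation.Theorems.SteadyStatesLoudBounded.GpAdmissible.stub_gpAdmissible

/-- `‖f_GP‖₂² = 3/2` (landed, `Negative/LevelFloor.lean`). -/
theorem integral_norm_sq_gpForce : ∫ x, ‖gpForce x‖ ^ 2 = 3 / 2 :=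
  Summit.AnomalousDissipation.AnomalousDissipation.Theorems.GPMeanBoundedFamily.Negative.integral_norm_sq_gpForce

/-- The `H`-lift clause of the crux for one path. -/
def IsLift (u : ℝ → UnitAddTorus (Fin 3) → EuclideanSpace ℝ (Fin 3)) (U : ℝ → Torus.energySpace (Fin 3)) : Prop :=
  ∀ t, 0 ≤ t → ((U t : Lp (EuclideanSpace ℝ (Fin 3)) 2 (volume : Measure (UnitAddTorus (Fin 3)))) :
    UnitAddTorus (Fin 3) → EuclideanSpace ℝ (Fin 3)) =ᵐ[volume] u t

/-- The FRAME of the crux: viscosities `ν_j ∈ (0,1]` tending to `0`, global Leray–Hopf solutions `u_j` of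
NS_{ν_j}(f_GP) from data `u₀ⱼ`, with `H`-valued lifts `U_j`. -/
def IsLiftedFamily (ν : ℕ → ℝ) (u₀ : ℕ → UnitAddTorus (Fin 3) → EuclideanSpace ℝ (Fin 3))
    (u : ℕ → ℝ → UnitAddTorus (Fin 3) → EuclideanSpace ℝ (Fin 3)) (U : ℕ → ℝ → Torus.energySpace (Fin 3)) : Prop :=
  (∀ j, 0 < ν j ∧ ν j ≤ 1) ∧ Tendsto ν atTop (nhds 0) ∧
    (∀ j, Torus.IsGlobalLerayHopf (ν j) (fun _ => gpForce) (u₀ j) (u j)) ∧ ∀ j, IsLift (u j) (U j)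

/-- **The crux unfolded**: `B ↔` some lifted family has `ν`-uniformly bounded limsup-mean energy. -/
theorem crux_iff : B ↔ ∃ (E : ℝ) (ν : ℕ → ℝ) (u₀ : ℕ → UnitAddTorus (Fin 3) → EuclideanSpace ℝ (Fin 3))
    (u : ℕ → ℝ → UnitAddTorus (Fin 3) → EuclideanSpace ℝ (Fin 3)) (U : ℕ → ℝ → Torus.energySpace (Fin 3)),
    IsLiftedFamily ν u₀ u U ∧ ∀ j, meanEnergy (u j) ≤ E := by
  constructor
  · intro h
    obtain ⟨E, ν, u₀, u, U, hν, hν0, hLH, hU, hE⟩ := h gpForce gpForce_eq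
    exact ⟨E, ν, u₀, u, U, ⟨hν, hν0, hLH, hU⟩, hE⟩
  · rintro ⟨E, ν, u₀, u, U, ⟨hν, hν0, hLH, hU⟩, hE⟩ f hf
    have hfg : f = gpForce := hf.trans gpForce_eq.symm
    subst hfg
    exact ⟨E, ν, u₀, u, U, hν, hν0, hLH, hU, hE⟩

/-! ## §1 The power budget at f_GP -/

/-- **Doering–Foias power budget at f_GP**: for every global Leray–Hopf solution of NS_ν(f_GP), `ν > 0`, any datum,
`ε = ⟨ν‖∇u‖²⟩ ≤ ⟨(f_GP, u)⟩ ≤ ‖f_GP‖₂ ⟨‖u‖²⟩^{1/2} = √(3/2)·√(meanEnergy u)` (landed chain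
`DoeringFoias2002_dissipation_le_power_holds`, `Torus.IsGlobalLerayHopf.meanPower_le`). -/
theorem meanDissipation_le {ν : ℝ} (hν : 0 < ν) {u₀ : UnitAddTorus (Fin 3) → EuclideanSpace ℝ (Fin 3)}
    {u : ℝ → UnitAddTorus (Fin 3) → EuclideanSpace ℝ (Fin 3)}
    (hu : Torus.IsGlobalLerayHopf ν (fun _ => gpForce) u₀ u) :
    meanDissipation ν u ≤ Real.sqrt (3 / 2) * Real.sqrt (meanEnergy u) := by
  obtain ⟨hsm, -, hzm⟩ := gpForce_admissible
  have h1 : meanDissipation ν u ≤ meanPower gpForce u :=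
    DoeringFoias2002_dissipation_le_power_holds hν (hsm.memLp 2) hzm u₀ u hu
  have h2 := hu.meanPower_le hν hsm hzm
  rw [rmsVelocity_eq_sqrt_meanEnergy, integral_norm_sq_gpForce] at h2
  exact h1.trans h2

/-! ## §S Strengthen: the relative floor `ε_j ≥ c·E_j` is the summit at f_GP -/

/-- **S⁺_rel (relative floor).** SOME lifted family of NS_{ν_j}(f_GP), `ν_j → 0`, pays dissipation proportional to its
own mean energy: `c · meanEnergy (u_j) ≤ meanDissipation (ν_j) (u_j)` for all `j` — equivalently its mean
enstrophy/energy ratio is `≥ c/ν_j` (Taylor microscale `≲ √ν_j`), the K41 expectation (`c ≈ ε/E ≈ 0.4` in the hub's DNS). -/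
def RelativeFloorFamily (c : ℝ) : Prop :=
  ∃ (ν : ℕ → ℝ) (u₀ : ℕ → UnitAddTorus (Fin 3) → EuclideanSpace ℝ (Fin 3))
    (u : ℕ → ℝ → UnitAddTorus (Fin 3) → EuclideanSpace ℝ (Fin 3)) (U : ℕ → ℝ → Torus.energySpace (Fin 3)),
    IsLiftedFamily ν u₀ u U ∧ ∀ j, c * meanEnergy (u j) ≤ meanDissipation (ν j) (u j)

/-- A relative floor caps the mean energy: `c·E ≤ ε ≤ √(3/2)·√E` forces `E ≤ 3/(2c²)`. -/
theorem meanEnergy_le_of_relativeFloor {c ν : ℝ} (hc : 0 < c) (hν : 0 < ν)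
    {u₀ : UnitAddTorus (Fin 3) → EuclideanSpace ℝ (Fin 3)} {u : ℝ → UnitAddTorus (Fin 3) → EuclideanSpace ℝ (Fin 3)}
    (hu : Torus.IsGlobalLerayHopf ν (fun _ => gpForce) u₀ u) (h : c * meanEnergy u ≤ meanDissipation ν u) :
    meanEnergy u ≤ 3 / (2 * c ^ 2) := by
  have hE0 : 0 ≤ meanEnergy u := meanEnergy_nonneg u
  have key : c * meanEnergy u ≤ Real.sqrt (3 / 2) * Real.sqrt (meanEnergy u) := h.trans (meanDissipation_le hν hu)
  have hsq : Real.sqrt (meanEnergy u) ^ 2 = meanEnergy u := Real.sq_sqrt hE0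
  have hs0 : 0 ≤ Real.sqrt (meanEnergy u) := Real.sqrt_nonneg _
  have ha0 : 0 ≤ Real.sqrt (3 / 2) := Real.sqrt_nonneg _
  -- `c √E ≤ √(3/2)`
  have h1 : c * Real.sqrt (meanEnergy u) ≤ Real.sqrt (3 / 2) := by
    by_cases h0 : Real.sqrt (meanEnergy u) = 0
    · rw [h0, mul_zero]; exact ha0
    · have hpos : 0 < Real.sqrt (meanEnergy u) := lt_of_le_of_ne hs0 (Ne.symm h0)
      have h3 : c * Real.sqrt (meanEnergy u) * Real.sqrt (meanEnergy u) ≤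
          Real.sqrt (3 / 2) * Real.sqrt (meanEnergy u) := by
        have h4 : c * Real.sqrt (meanEnergy u) ^ 2 ≤ Real.sqrt (3 / 2) * Real.sqrt (meanEnergy u) := by
          rw [hsq]; exact key
        nlinarith [h4]
      exact le_of_mul_le_mul_right h3 hpos
  have h2 : Real.sqrt (meanEnergy u) ≤ Real.sqrt (3 / 2) / c := by
    rw [le_div_iff₀ hc]; linarith
  calc meanEnergy u = Real.sqrt (meanEnergy u) ^ 2 := hsq.symm
    _ ≤ (Real.sqrt (3 / 2) / c) ^ 2 := pow_le_pow_left₀ hs0 h2 2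
    _ = 3 / (2 * c ^ 2) := by
        rw [div_pow, Real.sq_sqrt (by norm_num : (0 : ℝ) ≤ 3 / 2)]
        field_simp

/-- **S⁺_rel → B** (level `E = 3/(2c²)`). -/
theorem crux_of_relativeFloor {c : ℝ} (hc : 0 < c) (h : RelativeFloorFamily c) : B := by
  rw [crux_iff]
  obtain ⟨ν, u₀, u, U, hfam, hrel⟩ := h
  exact ⟨3 / (2 * c ^ 2), ν, u₀, u, U, hfam, fun j =>
    meanEnergy_le_of_relativeFloor hc (hfam.1 j).1 (hfam.2.2.1 j) (hrel j)⟩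

/-- **S⁺_rel → THE SUMMIT.**  With the landed Doering–Foias level floor of f_GP (`Negative.exists_meanEnergy_floor`:
every Leray–Hopf solution of NS_ν(f_GP), `ν ≤ 1`, has `meanEnergy ≥ e₀ > 0`) the relative floor is an ABSOLUTE floor
`ε_j ≥ c e₀`, and with `crux_of_relativeFloor` the energies are bounded: the zeroth law holds with witness `f_GP`.
So S⁺_rel is not a strengthening one can aim at "short of the summit" — it IS the summit at f_GP. -/
theorem anomalousDissipation_of_relativeFloor {c : ℝ} (hc : 0 < c) (h : RelativeFloorFamily c) :
    _root_.AnomalousDissipation := by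
  obtain ⟨ν, u₀, u, U, ⟨hν, hν0, hLH, -⟩, hrel⟩ := h
  obtain ⟨hsm, hdf, hzm⟩ := gpForce_admissible
  obtain ⟨e₀, he₀, hfloor⟩ :=
    Summit.AnomalousDissipation.AnomalousDissipation.Theorems.GPMeanBoundedFamily.Negative.exists_meanEnergy_floor
  have hEj : ∀ j, meanEnergy (u j) ≤ 3 / (2 * c ^ 2) := fun j =>
    meanEnergy_le_of_relativeFloor hc (hν j).1 (hLH j) (hrel j)
  have hεj : ∀ j, c * e₀ ≤ meanDissipation (ν j) (u j) := fun j => by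
    have hfl : e₀ ≤ meanEnergy (u j) := hfloor (ν j) (u₀ j) (u j) (hν j).1 (hν j).2 (hLH j)
    calc c * e₀ ≤ c * meanEnergy (u j) := mul_le_mul_of_nonneg_left hfl hc.le
      _ ≤ meanDissipation (ν j) (u j) := hrel j
  exact ⟨gpForce, hsm, hdf, hzm, ν, u₀, u, fun j => (hν j).1, hν0, hLH, ⟨3 / (2 * c ^ 2), hEj⟩,
    c * e₀, mul_pos hc he₀, hεj⟩

/-- The LIFTED ZEROTH LAW AT f_GP: the summit's body with the force pinned to f_GP, viscosities in `(0,1]` and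
`H`-lifts (i.e. exactly what routes EnsembleRigidity / TameRoughRigidity produce through `closes`). -/
def GPZerothLawLifted : Prop :=
  ∃ (ν : ℕ → ℝ) (u₀ : ℕ → UnitAddTorus (Fin 3) → EuclideanSpace ℝ (Fin 3))
    (u : ℕ → ℝ → UnitAddTorus (Fin 3) → EuclideanSpace ℝ (Fin 3)) (U : ℕ → ℝ → Torus.energySpace (Fin 3)),
    IsLiftedFamily ν u₀ u U ∧ (∃ E : ℝ, ∀ j, meanEnergy (u j) ≤ E) ∧
      ∃ ε : ℝ, 0 < ε ∧ ∀ j, ε ≤ meanDissipation (ν j) (u j)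

/-- **B is the NECESSARY half** of the lifted zeroth law at f_GP (projection). -/
theorem crux_of_gpZerothLawLifted (h : GPZerothLawLifted) : B := by
  rw [crux_iff]
  obtain ⟨ν, u₀, u, U, hfam, ⟨E, hE⟩, -⟩ := h
  exact ⟨E, ν, u₀, u, U, hfam, hE⟩

/-- The lifted zeroth law at f_GP decides the summit (projection; admissibility of f_GP). -/
theorem anomalousDissipation_of_gpZerothLawLifted (h : GPZerothLawLifted) : _root_.AnomalousDissipation := by
  obtain ⟨ν, u₀, u, U, ⟨hν, hν0, hLH, -⟩, ⟨E, hE⟩, ε, hε, hεj⟩ := h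
  obtain ⟨hsm, hdf, hzm⟩ := gpForce_admissible
  exact ⟨gpForce, hsm, hdf, hzm, ν, u₀, u, fun j => (hν j).1, hν0, hLH, ⟨E, hE⟩, ε, hε, hεj⟩

/-- **Converse: the lifted zeroth law at f_GP gives a relative floor** (`c = ε / max E 1`).  Together with
`anomalousDissipation_of_relativeFloor` and `crux_of_gpZerothLawLifted`:  S⁺_rel ⟺ lifted zeroth law at f_GP ⟹ B,
i.e. the relative-floor strengthening of B is EXACTLY summit-strength at the pinned force. -/
theorem relativeFloor_of_gpZerothLawLifted (h : GPZerothLawLifted) : ∃ c : ℝ, 0 < c ∧ RelativeFloorFamily c := by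
  obtain ⟨ν, u₀, u, U, hfam, ⟨E, hE⟩, ε, hε, hεj⟩ := h
  set E' : ℝ := max E 1 with hE'
  have hE'pos : 0 < E' := lt_of_lt_of_le one_pos (le_max_right _ _)
  refine ⟨ε / E', div_pos hε hE'pos, ν, u₀, u, U, hfam, fun j => ?_⟩
  have hEj : meanEnergy (u j) ≤ E' := (hE j).trans (le_max_left _ _)
  have h0 : 0 ≤ meanEnergy (u j) := meanEnergy_nonneg (u j)
  calc ε / E' * meanEnergy (u j) ≤ ε / E' * E' :=
        mul_le_mul_of_nonneg_left hEj (div_pos hε hE'pos).le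
    _ = ε := div_mul_cancel₀ ε hE'pos.ne'
    _ ≤ meanDissipation (ν j) (u j) := hεj j

/-- S⁺_rel gives the lifted zeroth law at f_GP (so the two are equivalent up to the constant). -/
theorem gpZerothLawLifted_of_relativeFloor {c : ℝ} (hc : 0 < c) (h : RelativeFloorFamily c) : GPZerothLawLifted := by
  obtain ⟨ν, u₀, u, U, hfam, hrel⟩ := h
  obtain ⟨e₀, he₀, hfloor⟩ :=
    Summit.AnomalousDissipation.AnomalousDissipation.Theorems.GPMeanBoundedFamily.Negative.exists_meanEnergy_floor
  refine ⟨ν, u₀, u, U, hfam, ⟨3 / (2 * c ^ 2), fun j =>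
    meanEnergy_le_of_relativeFloor hc (hfam.1 j).1 (hfam.2.2.1 j) (hrel j)⟩, c * e₀, mul_pos hc he₀, fun j => ?_⟩
  have hfl : e₀ ≤ meanEnergy (u j) :=
    hfloor (ν j) (u₀ j) (u j) (hfam.1 j).1 (hfam.1 j).2 (hfam.2.2.1 j)
  calc c * e₀ ≤ c * meanEnergy (u j) := mul_le_mul_of_nonneg_left hfl hc.le
    _ ≤ meanDissipation (ν j) (u j) := hrel j

/-! ## §D Decomposition: the ensemble split (mean form) and its thin seam -/

/-- **Sub₁ (ensemble form of B).** Along some `ν_j ∈ (0,1] → 0` there are FMRT stationary statistical solutions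
`μ_j` of NS_{ν_j}(f_GP) (probability, finite mean enstrophy, cylindrical Liouville identity, shell energy
inequalities) with integrable and `ν`-UNIFORMLY bounded mean energy `∫‖v‖² dμ_j ≤ E`.  (Ideator 2's
`sup_j E_min(ν_j) < ∞`; by Bronzi–Mondaini–Rosa 2026, arXiv:2606.12825, `E_min(ν)` over the Foias–Prodi class has
an exact minimax/certificate formula — see the census, §N3.) -/
def GPEnsembleMeanBoundedFamily : Prop :=
  ∃ (E : ℝ) (ν : ℕ → ℝ) (μ : ℕ → Measure (Torus.energySpace (Fin 3))),
    (∀ j, 0 < ν j ∧ ν j ≤ 1) ∧ Tendsto ν atTop (nhds 0) ∧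
      ∀ j, Torus.IsStationaryStatisticalSolution (ν j) gpForce (μ j) ∧
        Integrable (fun v : Torus.energySpace (Fin 3) => ‖v‖ ^ 2) (μ j) ∧ Torus.ensembleEnergy (μ j) ≤ E

/-- **Sub₂ (mean realisation).** At fixed `ν ∈ (0,1]`, an FMRT stationary statistical solution of NS_ν(f_GP) with mean
energy `≤ E` is accompanied, for every `δ > 0`, by ONE global Leray–Hopf path with an `H`-lift and limsup-mean energy
`≤ E + δ`.  Known for Dirac masses at steady states (landed `SteadyWeakIsGlobalLerayHopf`) and — by ergodic
decomposition + Birkhoff on the trajectory space — for time-average / Vishik–Fursikov stationary statistical solutions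
(Foias–Rosa–Temam 2019, arXiv:1606.02174, §§4.2–4.3, Thm 5.1/5.5); OPEN for a general Foias–Prodi/FMRT measure in
`d = 3` (whether every FMRT stationary statistical solution is carried by Leray–Hopf trajectories is not known). -/
def MeanRealisation : Prop :=
  ∀ (ν E δ : ℝ) (μ : Measure (Torus.energySpace (Fin 3))), 0 < ν → ν ≤ 1 → 0 < δ →
    Torus.IsStationaryStatisticalSolution ν gpForce μ →
    Integrable (fun v : Torus.energySpace (Fin 3) => ‖v‖ ^ 2) μ → Torus.ensembleEnergy μ ≤ E →
      ∃ (u₀ : UnitAddTorus (Fin 3) → EuclideanSpace ℝ (Fin 3)) (u : ℝ → UnitAddTorus (Fin 3) → EuclideanSpace ℝ (Fin 3))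
        (U : ℝ → Torus.energySpace (Fin 3)),
        Torus.IsGlobalLerayHopf ν (fun _ => gpForce) u₀ u ∧ IsLift u U ∧ meanEnergy u ≤ E + δ

/-- **The ensemble split composes** (`δ = 1`, level `E + 1`): `Sub₁ → Sub₂ → B`.  The proof is a choice along `j` —
a THIN seam: all the `ν`-uniformity lives in Sub₁, which is B in ensemble dress (its only known supply is time averages
of the very families B asks for, or Galerkin invariant measures with the same unknown bound). -/
theorem crux_of_ensembleSplit (h₁ : GPEnsembleMeanBoundedFamily) (h₂ : MeanRealisation) : B := by
  rw [crux_iff]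
  obtain ⟨E, ν, μ, hν, hν0, hμ⟩ := h₁
  choose u₀ u U hLH hlift hbd using fun j =>
    h₂ (ν j) E 1 (μ j) (hν j).1 (hν j).2 one_pos (hμ j).1 (hμ j).2.1 (hμ j).2.2
  exact ⟨E + 1, ν, u₀, u, U, ⟨hν, hν0, hLH, hlift⟩, hbd⟩

/-! ## §N Negation: what a disproof must deliver first -/

/-- **Universal divergence of the REST family**: for every level `E` there is `ν₀ > 0` such that for all
`ν ∈ (0, ν₀)` EVERY global Leray–Hopf solution of NS_ν(f_GP) from rest with an `H`-lift has `meanEnergy > E`. -/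
def RestFamilyDiverges : Prop :=
  ∀ E : ℝ, ∃ ν₀ : ℝ, 0 < ν₀ ∧ ∀ ν : ℝ, 0 < ν → ν < ν₀ →
    ∀ (u : ℝ → UnitAddTorus (Fin 3) → EuclideanSpace ℝ (Fin 3)) (U : ℝ → Torus.energySpace (Fin 3)),
      Torus.IsGlobalLerayHopf ν (fun _ => gpForce) 0 u → IsLift u U → E < meanEnergy u

/-- **`¬B → RestFamilyDiverges`** (PROVED): a disproof of the crux must in particular show that the lifted Leray–Hopf
paths FROM REST overshoot every energy level at all small viscosities — the statement every DNS of NS_ν(f_GP) in the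
hub contradicts (rest/odd/full-space runs, `ν = 0.02 … 0.0025`: late mean energies `0.47 … 1.9`, injection
`ν`-independent).  Proof: if the rest paths stayed below `E` along arbitrarily small viscosities, choosing one per
`ν₀ = 1/(j+1)` gives a witness family of B. -/
theorem restFamilyDiverges_of_not_crux (h : ¬ B) : RestFamilyDiverges := by
  by_contra hcon
  apply h
  rw [crux_iff]
  unfold RestFamilyDiverges at hcon
  push Not at hcon
  obtain ⟨E, hE⟩ := hcon
  -- one bounded rest path below each `ν₀ = 1/(j+1)`
  have key : ∀ j : ℕ, ∃ (ν : ℝ) (u : ℝ → UnitAddTorus (Fin 3) → EuclideanSpace ℝ (Fin 3))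
      (U : ℝ → Torus.energySpace (Fin 3)), 0 < ν ∧ ν < 1 / ((j : ℝ) + 1) ∧
      Torus.IsGlobalLerayHopf ν (fun _ => gpForce) 0 u ∧ IsLift u U ∧ meanEnergy u ≤ E := fun j => by
    obtain ⟨ν, hν, hνlt, u, U, hu, hU, hEu⟩ := hE (1 / ((j : ℝ) + 1)) (by positivity)
    exact ⟨ν, u, U, hν, hνlt, hu, hU, hEu⟩
  choose ν u U hν hνlt hLH hU hEu using key
  have hν1 : ∀ j, ν j ≤ 1 := fun j => by
    have h1 : 1 / ((j : ℝ) + 1) ≤ 1 := by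
      rw [div_le_one (by positivity)]; linarith [(Nat.cast_nonneg j : (0 : ℝ) ≤ j)]
    exact ((hνlt j).le.trans h1)
  have hν0 : Tendsto ν atTop (nhds 0) := by
    refine squeeze_zero (fun j => (hν j).le) (fun j => (hνlt j).le) ?_
    exact tendsto_one_div_add_atTop_nhds_zero_nat
  exact ⟨E, ν, fun _ => 0, u, U, ⟨fun j => ⟨hν j, hν1 j⟩, hν0, hLH, hU⟩, hEu⟩

end Summit.AnomalousDissipation.AnomalousDissipation.Cruxes.GPMeanBoundedFamily.StrategyCensus

end
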